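import Summits.Ventures.HSemireg.ComponentLadderG2nCofinal
import Summits.Ventures.HSemireg.Statement
import Summits.Ventures.HSemireg.SubschemeSeed
import Summits.Ventures.HSemireg.BlochSpreadUnconditional
import Literature.AlgebraicGeometry.HodgeTheory.BlochSemiregularSpreadFromSubscheme
import Literature.AlgebraicGeometry.HodgeTheory.BlochSemiregularSpreadSmoothComponentsOfSubscheme
import Literature.AlgebraicGeometry.HodgeTheory.ComplexOrientationDegreeFormulaHolds
import HarnessLib

/-!
# Venture HSemireg — the component ladder for the cell's LCI object kinds at EVERY level `N`, DOOR-INDEPENDENT over the local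
# clause and on ONE printed lci fact per level (or, for integral seeds, on the two OBJECT-level printed facts)

HONEST FRAMING. Assembly leaf of a COMPUTATION cell (`pub-hsemireg`, Sunday typer seat p11 «assembly, g = 2n», sixth generation; companion of
`ComponentLadderG2n.lean` ∕ `ComponentLadderG2nCofinal.lean`). Every published input is a hypothesis BY NAME — Deligne's reach-by-similitude
`weilFamilyReach_similar` (REFEREED named fact); in §2 ∕ §4 Bloch's theorem for an ARBITRARY local complete intersection
`BlochSemiregularSpreadOfSubscheme (2N) N` (Bloch 1972 (7.1)/(7.4), Buchweitz–Flenner Thm. 5.2 at `I = {p}`, class `= [Z]`; REFEREED named fact)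
and Buchweitz–Flenner Thm. 5.1 `BuchweitzFlenner2003_variationalHodge_ISemiregular`; in §3 the two OBJECT-level printed facts
`Bloch1972_semiregularSubschemeLifts` (Bloch (7.1) + Hilbert point + Artin) and `fulton1998_flatFamily_cycleClass_specialises` (Fulton Cor. 10.1 ∕
19.2) — every object a hypothesis BY VALUE (a seed on a Weil-type member); nothing here says HC, HC_CM or HC_AV is proved, and by the signed
verdict (`target-g6/VERDICT-G6.md` v1.0 `1651dcc7322662a2`) NO census row supplies a seed on any deciding component. THEOREMS ONLY (one-line
compositions of tree theorems): 0 `sorry`, 0 `def`, 0 new named fact, no new axiom.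

## Why this leaf

The p11 ladder files type the component ladder for an admissible OBJECT CLASS `𝒪` (`LocalVariationalHodgeFor 𝒪` ∧ `HasSeedOn 𝒪`, the
Buchweitz–Flenner ∕ Pridham binder shape) and for route (C). The cell's three LCI object kinds — an integral Bloch-semiregular lci
(`HasBlochSeedAt`, door D1), a reduced lci union with smooth components (`HasBlochUnionSeedAt`, D1′, Schoen's `Δ ∪ (C × C)` shape), an arbitrary
lci subscheme (`HasBlochSubschemeSeedAt`, D1″) — reach the cell predicate `WeilClassesComponent n d δ` in `ComponentCells.lean` §1 at the member's
OWN level only, each on ITS class-level transport fact (`BlochSemiregularSpread`, `BlochSemiregularSpreadSmoothComponents`,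
`BlochSemiregularSpreadOfSubscheme`). Since then the tree PROVED (a) `blochSemiregularSpread_of_subscheme` and
`blochSemiregularSpreadSmoothComponents_of_subscheme` (Literature; the degree formula for complex orientations it needs is the tree theorem
`Fulton1998_degreeFormula_complexOrientation_holds`) — the first two transport facts FOLLOW from the third — and (b)
`Bloch1972.blochSemiregularSpread_of_blochLifts_of_fulton (n p)` (`BlochSpreadUnconditional.lean`, s4-bridge-1; the iso-invariance of Bloch
semiregularity discharged by `IsBlochSemiregular.comp_iso`) — the integral door's transport fact follows from the two OBJECT-level printed facts
ALONE. `TwelvefoldDoorLciOneFact.lean` (s4-bridge-1) draws the consequence at the S4 rung `n = 6` for SPLIT twelvefolds. HERE, at every level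
`N` and for a member of ANY component (split or not):

§1 DOOR-INDEPENDENT LADDER over the LOCAL CLAUSE (`WeilAnchorLocalClause N d P h_K w`, the currency every door of the cell produces —
   `ComponentCells.weilClassesComponent_of_localClause_member` is conjunct (i)): reach-by-similitude ∧ a polarized Weil-type `(N, d)` member of the
   component `δ` ∧ `w ≠ 0` rational Weil ∧ the local clause at `(P, h_K, w)` ⟹ `WeilClassesComponent N d δ` ∧ every component `(n, d, δ')` and
   `WeilAlgebraicAll n d` for every `1 ≤ n < N` (Schoen ¶10 iterated — `ComponentLadderG2n` §1, tree theorems); component-free member form; the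
   GENERAL members of all these components (van Geemen 6.12, ring 2 binder-free); COFINAL local-clause members ⟹ R∞ `WeilClassesImaginaryQuadratic`
   and `Ring2Transport.HodgeGeneralWeilType`. The object-class ladder of `ComponentLadderG2n` §2 is the special case
   `weilAnchorLocalClause_of_localVariationalHodgeFor_of_seedOn` (tree theorem); a door the tree does not type enters through `hloc`.
§2 THE THREE LCI DOORS ON ONE FACT: `BlochSemiregularSpreadOfSubscheme (2N) N` ∧ (integral ∨ union ∨ subscheme seed) ⟹ the local clause
   (`weilAnchorLocalClause_of_subschemeFact_of_lciSeed`), hence the §1 ladder from an lci seed on a member of ANY component, and R∞ from cofinal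
   lci-seeded members granting the fact at every level.
§3 FINEST PROVENANCE for integral seeds: the same ladder and R∞ on `Bloch1972_semiregularSubschemeLifts` ∧ `fulton1998_flatFamily_cycleClass_specialises`
   (object level) in place of any class-level transport fact.
§4 THE CELL'S TWO STATEMENTS OF RECORD (`Statement.lean`: split form over `weilFamilyReach_hyperbolic`, component form over `weilFamilyReach_similar`,
   seed = integral ∨ union ∨ `I`-semiregular vector bundle) with the two Bloch transport facts replaced by the ONE lci fact (BF Thm. 5.1 kept for
   the sheaf kind): trust base {`BlochSemiregularSpreadOfSubscheme (2n) n`, BF 5.1, reach} instead of {`BlochSemiregularSpread (2n) n`,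
   `BlochSemiregularSpreadSmoothComponents (2n) n`, BF 5.1, reach}.
§5 READINGS: `N = 3` (a sixfold cell — the DECIDING-row form of § V-1 — and all fourfolds, on `BlochSemiregularSpreadOfSubscheme 6 3`) and `N = 4`
   (an eightfold component ⟹ every sixfold cell, the non-split ones included, and all fourfolds, on `BlochSemiregularSpreadOfSubscheme 8 4`).

In print: split members at `(n, n+1) = (2, 3)` (Schoen 1998 ¶10, `K = ℚ(√-3)`; Markman arXiv:2502.03415 Cor. 1.6.1); a Bloch-semiregular lci
carrying a Weil class on a NON-split sixfold or on any Weil-type `2N`-fold, `N ≥ 4`: no printed instance and, by the signed verdict, no census object.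

References: [Bloch1972Semiregularity] Thm. (7.1) p. 64, Thm. (7.4) and Remark (7.5) p. 65; [BuchweitzFlenner2003] Thm. 5.1, Thm. 5.2, proof of
Cor. 4.12, (8.1), Prop. 8.2; [Fulton1998] §1.5, §10.1 Cor. 10.1, Lemma 19.1.2, §19.2 Cor. 19.2 (b); [Deligne1982HodgeCycles] §4 Cor. 4.2, proof of
Thm. 4.8; [vanGeemen1994HodgeAV] 4.9, 4.14, Lemma 5.2, Thm. 5.3, Thm. 6.11–6.12; [Schoen1998HodgeWeilAddendum] 10 (Proposition), p. 332;
[Weil1977HodgeRing] §3; [Markman2025SecantWeil] Thm. 1.5.1, Cor. 1.6.1 (preprint); [Markman2025SurveySecant] §4, §11.5, §12 (preprint).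
-/

noncomputable section

open CategoryTheory CategoryTheory.Limits AlgebraicGeometry Set
open Literature.AlgebraicGeometry Literature.AlgebraicGeometry.Motives Literature.AlgebraicGeometry.Modules
open Literature.AlgebraicGeometry.HodgeTheory Literature.AlgebraicGeometry.KTheory Literature.AlgebraicGeometry.VanGeemen1994
open Literature.AlgebraicGeometry.ModuliOfAbelianVarieties Literature.AlgebraicGeometry.Deligne1982 Literature.AlgebraicTopology.SingularHomology

namespace Summit.Ventures.HSemireg

open Summit.HodgeConjecture.HodgeConjecture Summit.HodgeConjecture.HodgeConjecture.WeilTypeLadder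
open Summit.HodgeConjecture.HodgeConjecture.Cruxes.HodgeAbelianVarieties.EStepSecantInduction
open Summit.HodgeConjecture.HodgeConjecture.Ring2.Hypotheses Summit.HodgeConjecture.HodgeConjecture.Ring2.AbelianAll
open Summit.Ventures.HSemireg.GeneralStructure

/-! ## §1 DOOR-INDEPENDENT: the component ladder over the LOCAL CLAUSE at a member of ANY component -/

section LocalClause

/-- **THE COMPONENT LADDER over the local clause, every level `N ≥ 1`, door-independent.** BY NAME: Deligne's reach-by-similitude
`weilFamilyReach_similar` (REFEREED). BY VALUE: a polarized member `(P, ψ₀, h_K = symmetrisedClass d P ψ₀ e a)` of Weil type `(N, d)` of the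
component `(N, d, δ)` (split OR non-split), a non-zero rational Weil class `w` on it, and the LOCAL VARIATIONAL CLAUSE at that anchor
(`WeilAnchorLocalClause N d P h_K w`: along every smooth projective `√-d`-Weil family through a chart at `P` carrying `h_K`, `w` as global classes,
`q·h_Kᴺ + w` stays algebraic near `P` — the output of EVERY door of the cell: Bloch lci ∕ union ∕ subscheme, BF sheaf, object class `𝒪`, route (C)).
CONCLUSION: (i) `WeilClassesComponent N d δ`; (ii) every component `(n, d, δ')`, `1 ≤ n < N`; (iii) `WeilAlgebraicAll n d`, `1 ≤ n < N`. The descent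
uses NO named fact (the member forces `sign δ = (-1)^N`; Schoen ¶10 iterated, `ComponentLadderG2n` §1). [cite: Deligne1982HodgeCycles, proof of Thm. 4.8]
[cite: Schoen1998HodgeWeilAddendum, 10 (Proposition), p. 332] [cite: vanGeemen1994HodgeAV, Lemma 5.2 (3)–(4) and Thm. 5.3] -/
theorem componentLadder_of_localClause_member (hF : weilFamilyReach_similar) {N d : ℕ} {δ : weilNormResidueGroup d}
    {P : AbelianVariety ℂ} {ψ₀ : P ⟶ P} (hW : IsWeilType P ψ₀ N d) (e : ProjectiveEmbedding P.X)
    {a : complexBetti (projectiveSpace e.n ℂ) 2} (haQ : IsRationalClass a) (ha0 : a ≠ 0)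
    (hδ : HasWeilDiscriminantNondeg P ψ₀ N d (symmetrisedClass d P ψ₀ e a) δ)
    {w : complexBetti P.X (2 * N)} (hwW : w ∈ weilClassesOf P ψ₀ N d) (hwQ : IsRationalClass w) (hw0 : w ≠ 0)
    (hloc : WeilAnchorLocalClause N d P (symmetrisedClass d P ψ₀ e a) w) :
    WeilClassesComponent N d δ ∧
      (∀ n : ℕ, 0 < n → n < N → ∀ δ' : weilNormResidueGroup d, WeilClassesComponent n d δ') ∧
      ∀ n : ℕ, 0 < n → n < N → WeilAlgebraicAll n d :=
  have hC : WeilClassesComponent N d δ := weilClassesComponent_of_localClause_member hF hW e haQ ha0 hδ hwW hwQ hw0 hloc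
  have hsgn : weilSign d δ = (-1) ^ N := weilSign_eq_of_hasWeilDiscriminantNondeg hW e haQ ha0 hδ
  ⟨hC, fun _ hn hnN δ' ↦ weilClassesComponent_lt_of_weilClassesComponent hW.d_pos hsgn hC hn hnN δ',
    fun _ hn hnN ↦ weilAlgebraicAll_lt_of_weilClassesComponent hW.d_pos hsgn hC hn hnN⟩

/-- **Component-free member form over the local clause**: the member's discriminant class need not be named (van Geemen Lemma 5.2 (1)–(3),
`exists_hasWeilDiscriminantNondeg`): reach ∧ the local clause at a Weil-type `(N, d)` pair in a `K`-symmetrised hyperplane class ⟹ every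
component and `WeilAlgebraicAll` at every level `1 ≤ n < N`. [cite: vanGeemen1994HodgeAV, Lemma 5.2 (1)–(4)]
[cite: Schoen1998HodgeWeilAddendum, 10 (Proposition), p. 332] [cite: Deligne1982HodgeCycles, proof of Thm. 4.8] -/
theorem below_of_localClause_weilType (hF : weilFamilyReach_similar) {N d : ℕ} {P : AbelianVariety ℂ} {ψ₀ : P ⟶ P}
    (hW : IsWeilType P ψ₀ N d) (e : ProjectiveEmbedding P.X) {a : complexBetti (projectiveSpace e.n ℂ) 2} (haQ : IsRationalClass a)
    (ha0 : a ≠ 0) {w : complexBetti P.X (2 * N)} (hwW : w ∈ weilClassesOf P ψ₀ N d) (hwQ : IsRationalClass w) (hw0 : w ≠ 0)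
    (hloc : WeilAnchorLocalClause N d P (symmetrisedClass d P ψ₀ e a) w) :
    (∀ n : ℕ, 0 < n → n < N → ∀ δ' : weilNormResidueGroup d, WeilClassesComponent n d δ') ∧
      ∀ n : ℕ, 0 < n → n < N → WeilAlgebraicAll n d := by
  obtain ⟨δ, hδ⟩ := exists_hasWeilDiscriminantNondeg hW.pos hW.dim_eq hW.d_pos hW.sq_eq e haQ ha0
  exact (componentLadder_of_localClause_member hF hW e haQ ha0 hδ hwW hwQ hw0 hloc).2

/-- **The object-class ladder is the special case** (`ComponentLadderG2n.componentLadder_of_localVariationalHodgeFor_of_seedOn_member` re-derived):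
`LocalVariationalHodgeFor 𝒪 ∧ HasSeedOn 𝒪` produce the local clause by the tree theorem `weilAnchorLocalClause_of_localVariationalHodgeFor_of_seedOn`.
[cite: BuchweitzFlenner2003, §5 Thm. 5.1 (the argument shape)] [cite: Schoen1998HodgeWeilAddendum, 10 (Proposition), p. 332] -/
theorem componentLadder_of_localClause_of_localVariationalHodgeFor_of_seedOn_member {𝒪 : ObjClass} (hF : weilFamilyReach_similar)
    (hT : LocalVariationalHodgeFor 𝒪) {N d : ℕ} {δ : weilNormResidueGroup d}
    {P : AbelianVariety ℂ} {ψ₀ : P ⟶ P} (hW : IsWeilType P ψ₀ N d) (e : ProjectiveEmbedding P.X)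
    {a : complexBetti (projectiveSpace e.n ℂ) 2} (haQ : IsRationalClass a) (ha0 : a ≠ 0)
    (hδ : HasWeilDiscriminantNondeg P ψ₀ N d (symmetrisedClass d P ψ₀ e a) δ)
    {w : complexBetti P.X (2 * N)} (hwW : w ∈ weilClassesOf P ψ₀ N d) (hwQ : IsRationalClass w) (hw0 : w ≠ 0)
    (hS : HasSeedOn 𝒪 N P (symmetrisedClass d P ψ₀ e a) w) :
    WeilClassesComponent N d δ ∧
      (∀ n : ℕ, 0 < n → n < N → ∀ δ' : weilNormResidueGroup d, WeilClassesComponent n d δ') ∧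
      ∀ n : ℕ, 0 < n → n < N → WeilAlgebraicAll n d :=
  componentLadder_of_localClause_member hF hW e haQ ha0 hδ hwW hwQ hw0
    (weilAnchorLocalClause_of_localVariationalHodgeFor_of_seedOn d hT hS)

/-- **The GENERAL members of every component reached** (van Geemen Thm. 6.11–6.12, Weil 1977: `HodgeGeneralWeilTypeComponent` — the Hodge
conjecture for every member whose Hodge group at the class is `SU_H`; ring 2's binder-free `hodgeGeneralWeilTypeComponent_of_weilClassesComponent_discharged`):
the local clause at a member of `(N, d, δ)` ⟹ general members of that component and of every component `(n, d, δ')`, `n < N`. NOT the special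
members, NOT `HC_AV`. [cite: vanGeemen1994HodgeAV, Thm. 6.11–6.12 and Lemma 5.2] [cite: Weil1977HodgeRing, §3] -/
theorem hodgeGeneralWeilTypeComponents_of_localClause_member (hF : weilFamilyReach_similar) {N d : ℕ} {δ : weilNormResidueGroup d}
    {P : AbelianVariety ℂ} {ψ₀ : P ⟶ P} (hW : IsWeilType P ψ₀ N d) (e : ProjectiveEmbedding P.X)
    {a : complexBetti (projectiveSpace e.n ℂ) 2} (haQ : IsRationalClass a) (ha0 : a ≠ 0)
    (hδ : HasWeilDiscriminantNondeg P ψ₀ N d (symmetrisedClass d P ψ₀ e a) δ)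
    {w : complexBetti P.X (2 * N)} (hwW : w ∈ weilClassesOf P ψ₀ N d) (hwQ : IsRationalClass w) (hw0 : w ≠ 0)
    (hloc : WeilAnchorLocalClause N d P (symmetrisedClass d P ψ₀ e a) w) :
    HodgeGeneralWeilTypeComponent N d δ ∧
      ∀ n : ℕ, 0 < n → n < N → ∀ δ' : weilNormResidueGroup d, HodgeGeneralWeilTypeComponent n d δ' :=
  have h := componentLadder_of_localClause_member hF hW e haQ ha0 hδ hwW hwQ hw0 hloc
  ⟨hodgeGeneralWeilTypeComponent_of_weilClassesComponent_discharged hW.pos hW.d_pos h.1,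
    fun n hn hnN δ' ↦ hodgeGeneralWeilTypeComponent_of_weilClassesComponent_discharged hn hW.d_pos (h.2.1 n hn hnN δ')⟩

/-- **COFINAL local-clause members on ANY components ⟹ R∞ `WeilClassesImaginaryQuadratic`** (the Weil classes of every `ℚ(√-d)`-Weil abelian
`2n`-fold, every `n ≥ 2`, every `d`, every discriminant): if for every `n ≥ 2` and `d > 0` SOME level `N > n` carries a Weil-type `(N, d)` pair with
`w ≠ 0` and the local clause in a `K`-symmetrised hyperplane class. The door-free form of `ComponentLadderG2nCofinal` §2; nothing instantiated — the
census supplies no such member on a deciding component, nothing cofinal. NOT `HC_AV`. [cite: Weil1977HodgeRing, §3]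
[cite: Schoen1998HodgeWeilAddendum, 10 (Proposition), p. 332] [cite: Deligne1982HodgeCycles, proof of Thm. 4.8] [cite: Markman2025SurveySecant, §4 and §12 (preprint)] -/
theorem weilClassesImaginaryQuadratic_of_reach_of_cofinalLocalClauseMembers (hF : weilFamilyReach_similar)
    (hS : ∀ n : ℕ, 2 ≤ n → ∀ d : ℕ, 0 < d → ∃ (N : ℕ) (P : AbelianVariety ℂ) (ψ₀ : P ⟶ P) (e : ProjectiveEmbedding P.X)
      (a : complexBetti (projectiveSpace e.n ℂ) 2) (w : complexBetti P.X (2 * N)),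
      n < N ∧ IsWeilType P ψ₀ N d ∧ IsRationalClass a ∧ a ≠ 0 ∧ w ∈ weilClassesOf P ψ₀ N d ∧ IsRationalClass w ∧ w ≠ 0 ∧
        WeilAnchorLocalClause N d P (symmetrisedClass d P ψ₀ e a) w) :
    WeilClassesImaginaryQuadratic := by
  intro n hn d hd A φ hA _ hφ c hc hnn hcW
  obtain ⟨N, P, ψ₀, e, a, w, hnN, hW, haQ, ha0, hwW, hwQ, hw0, hloc⟩ := hS n hn d hd
  exact (below_of_localClause_weilType hF hW e haQ ha0 hwW hwQ hw0 hloc).2 n (by omega) hnN A φ hA hφ c hcW hc hnn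

/-- **… and then the Hodge conjecture for EVERY GENERAL abelian variety of Weil type with imaginary quadratic field** (`Ring2Transport.HodgeGeneralWeilType`,
van Geemen 6.12 in all `(n, d)`; ring 2's binder-free `hodgeGeneralWeilType_of_weilClassesImaginaryQuadratic_discharged`). NOT the special members,
NOT `HC_AV`; nothing instantiated. [cite: vanGeemen1994HodgeAV, Thm. 4.11 and Thm. 6.11–6.12] [cite: Weil1977HodgeRing, §3] -/
theorem hodgeGeneralWeilType_of_reach_of_cofinalLocalClauseMembers (hF : weilFamilyReach_similar)
    (hS : ∀ n : ℕ, 2 ≤ n → ∀ d : ℕ, 0 < d → ∃ (N : ℕ) (P : AbelianVariety ℂ) (ψ₀ : P ⟶ P) (e : ProjectiveEmbedding P.X)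
      (a : complexBetti (projectiveSpace e.n ℂ) 2) (w : complexBetti P.X (2 * N)),
      n < N ∧ IsWeilType P ψ₀ N d ∧ IsRationalClass a ∧ a ≠ 0 ∧ w ∈ weilClassesOf P ψ₀ N d ∧ IsRationalClass w ∧ w ≠ 0 ∧
        WeilAnchorLocalClause N d P (symmetrisedClass d P ψ₀ e a) w) :
    Ring2Transport.HodgeGeneralWeilType :=
  Ring2Transport.hodgeGeneralWeilType_of_weilClassesImaginaryQuadratic_discharged
    (weilClassesImaginaryQuadratic_of_reach_of_cofinalLocalClauseMembers hF hS)

end LocalClause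

/-! ## §2 The three LCI doors on ONE printed fact: `BlochSemiregularSpreadOfSubscheme (2N) N` -/

section OneLciFact

/-- **ONE lci fact serves the three lci doors.** Granting `BlochSemiregularSpreadOfSubscheme (2N) N` (Bloch (7.1)/(7.4) for an arbitrary local
complete intersection, class `[Z]`; REFEREED): an integral Bloch seed (`HasBlochSeedAt`, via the tree theorem `blochSemiregularSpread_of_subscheme`),
a reduced union seed with smooth components (`HasBlochUnionSeedAt`, via `blochSemiregularSpreadSmoothComponents_of_subscheme` and the tree theorem
`Fulton1998_degreeFormula_complexOrientation_holds`) or a subscheme seed (`HasBlochSubschemeSeedAt`) for `q·hᴺ + w` on `P` gives the local clause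
`WeilAnchorLocalClause N d P h w`, every `d`. [cite: Bloch1972Semiregularity, Thm. (7.1), Thm. (7.4) and Remark (7.5)]
[cite: BuchweitzFlenner2003, Thm. 5.2 and proof of Cor. 4.12] [cite: Fulton1998, §1.5 and Lemma 19.1.2] -/
theorem weilAnchorLocalClause_of_subschemeFact_of_lciSeed {N : ℕ} (d : ℕ) (hBS : BlochSemiregularSpreadOfSubscheme (2 * N) N)
    {P : AbelianVariety ℂ} {h : complexBetti P.X 2} {w : complexBetti P.X (2 * N)}
    (hseed : HasBlochSeedAt N P h w ∨ HasBlochUnionSeedAt N P h w ∨ HasBlochSubschemeSeedAt N P h w) :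
    WeilAnchorLocalClause N d P h w := by
  rcases hseed with hS | hS | hS
  · exact weilAnchorLocalClause_of_blochSpread_of_blochSeedAt d (blochSemiregularSpread_of_subscheme hBS) hS
  · exact weilAnchorLocalClause_of_blochSpreadSmoothComponents_of_unionSeedAt d
      (blochSemiregularSpreadSmoothComponents_of_subscheme Fulton1998_degreeFormula_complexOrientation_holds hBS) hS
  · exact weilAnchorLocalClause_of_blochSpreadOfSubscheme_of_subschemeSeedAt d hBS hS

/-- **THE LCI COMPONENT LADDER on ONE fact, every level `N ≥ 1`.** BY NAME: `weilFamilyReach_similar` and `BlochSemiregularSpreadOfSubscheme (2N) N`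
(both REFEREED). BY VALUE: a polarized Weil-type `(N, d)` member of the component `(N, d, δ)` (split or not), `w ≠ 0` rational Weil, and ONE lci
seed for `q·h_Kᴺ + w` there — integral Bloch-semiregular lci ∨ reduced union with smooth components ∨ arbitrary Bloch-semiregular lci subscheme.
CONCLUSION: the member's component ∧ every component `(n, d, δ')` and `WeilAlgebraicAll n d` for every `1 ≤ n < N`. `ComponentCells` D1 ∕ D1′ ∕ D1″
are conjunct (i) on their own facts; the descent is `ComponentLadderG2n` §1. [cite: Bloch1972Semiregularity, Thm. (7.4) and Remark (7.5)]
[cite: Deligne1982HodgeCycles, proof of Thm. 4.8] [cite: Schoen1998HodgeWeilAddendum, 10 (Proposition), p. 332] [cite: vanGeemen1994HodgeAV, Lemma 5.2 and Thm. 5.3] -/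
theorem componentLadder_of_subschemeFact_of_lciSeed_member (hF : weilFamilyReach_similar) {N d : ℕ} {δ : weilNormResidueGroup d}
    (hBS : BlochSemiregularSpreadOfSubscheme (2 * N) N)
    {P : AbelianVariety ℂ} {ψ₀ : P ⟶ P} (hW : IsWeilType P ψ₀ N d) (e : ProjectiveEmbedding P.X)
    {a : complexBetti (projectiveSpace e.n ℂ) 2} (haQ : IsRationalClass a) (ha0 : a ≠ 0)
    (hδ : HasWeilDiscriminantNondeg P ψ₀ N d (symmetrisedClass d P ψ₀ e a) δ)
    {w : complexBetti P.X (2 * N)} (hwW : w ∈ weilClassesOf P ψ₀ N d) (hwQ : IsRationalClass w) (hw0 : w ≠ 0)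
    (hseed : HasBlochSeedAt N P (symmetrisedClass d P ψ₀ e a) w ∨ HasBlochUnionSeedAt N P (symmetrisedClass d P ψ₀ e a) w ∨
      HasBlochSubschemeSeedAt N P (symmetrisedClass d P ψ₀ e a) w) :
    WeilClassesComponent N d δ ∧
      (∀ n : ℕ, 0 < n → n < N → ∀ δ' : weilNormResidueGroup d, WeilClassesComponent n d δ') ∧
      ∀ n : ℕ, 0 < n → n < N → WeilAlgebraicAll n d :=
  componentLadder_of_localClause_member hF hW e haQ ha0 hδ hwW hwQ hw0 (weilAnchorLocalClause_of_subschemeFact_of_lciSeed d hBS hseed)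

/-- **Component-free lci form on ONE fact**: an lci seed on ANY Weil-type `(N, d)` pair in a `K`-symmetrised hyperplane class ⟹ every level below.
[cite: Bloch1972Semiregularity, Thm. (7.4) and Remark (7.5)] [cite: vanGeemen1994HodgeAV, Lemma 5.2 (1)–(4)] -/
theorem below_of_subschemeFact_of_lciSeed_weilType (hF : weilFamilyReach_similar) {N d : ℕ}
    (hBS : BlochSemiregularSpreadOfSubscheme (2 * N) N) {P : AbelianVariety ℂ} {ψ₀ : P ⟶ P} (hW : IsWeilType P ψ₀ N d)
    (e : ProjectiveEmbedding P.X) {a : complexBetti (projectiveSpace e.n ℂ) 2} (haQ : IsRationalClass a) (ha0 : a ≠ 0)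
    {w : complexBetti P.X (2 * N)} (hwW : w ∈ weilClassesOf P ψ₀ N d) (hwQ : IsRationalClass w) (hw0 : w ≠ 0)
    (hseed : HasBlochSeedAt N P (symmetrisedClass d P ψ₀ e a) w ∨ HasBlochUnionSeedAt N P (symmetrisedClass d P ψ₀ e a) w ∨
      HasBlochSubschemeSeedAt N P (symmetrisedClass d P ψ₀ e a) w) :
    (∀ n : ℕ, 0 < n → n < N → ∀ δ' : weilNormResidueGroup d, WeilClassesComponent n d δ') ∧
      ∀ n : ℕ, 0 < n → n < N → WeilAlgebraicAll n d :=
  below_of_localClause_weilType hF hW e haQ ha0 hwW hwQ hw0 (weilAnchorLocalClause_of_subschemeFact_of_lciSeed d hBS hseed)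

/-- **COFINAL lci-seeded members on ANY components ⟹ R∞**, granting the lci fact at every level (`∀ N, BlochSemiregularSpreadOfSubscheme (2N) N` —
ONE printed theorem read at each level) and the reach-by-similitude. The cell's family-A ∕ Schoen-type cycle searches are searches for such
members; the signed census records none on a deciding component. NOT `HC_AV`. [cite: Weil1977HodgeRing, §3]
[cite: Bloch1972Semiregularity, Thm. (7.4) and Remark (7.5)] [cite: Schoen1998HodgeWeilAddendum, 10 (Proposition), p. 332] -/
theorem weilClassesImaginaryQuadratic_of_reach_of_subschemeFact_of_cofinalLciSeedMembers (hF : weilFamilyReach_similar)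
    (hBS : ∀ N : ℕ, BlochSemiregularSpreadOfSubscheme (2 * N) N)
    (hS : ∀ n : ℕ, 2 ≤ n → ∀ d : ℕ, 0 < d → ∃ (N : ℕ) (P : AbelianVariety ℂ) (ψ₀ : P ⟶ P) (e : ProjectiveEmbedding P.X)
      (a : complexBetti (projectiveSpace e.n ℂ) 2) (w : complexBetti P.X (2 * N)),
      n < N ∧ IsWeilType P ψ₀ N d ∧ IsRationalClass a ∧ a ≠ 0 ∧ w ∈ weilClassesOf P ψ₀ N d ∧ IsRationalClass w ∧ w ≠ 0 ∧
        (HasBlochSeedAt N P (symmetrisedClass d P ψ₀ e a) w ∨ HasBlochUnionSeedAt N P (symmetrisedClass d P ψ₀ e a) w ∨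
          HasBlochSubschemeSeedAt N P (symmetrisedClass d P ψ₀ e a) w)) :
    WeilClassesImaginaryQuadratic :=
  weilClassesImaginaryQuadratic_of_reach_of_cofinalLocalClauseMembers hF fun n hn d hd ↦ by
    obtain ⟨N, P, ψ₀, e, a, w, hnN, hW, haQ, ha0, hwW, hwQ, hw0, hseed⟩ := hS n hn d hd
    exact ⟨N, P, ψ₀, e, a, w, hnN, hW, haQ, ha0, hwW, hwQ, hw0, weilAnchorLocalClause_of_subschemeFact_of_lciSeed d (hBS N) hseed⟩

end OneLciFact

/-! ## §3 FINEST PROVENANCE for integral seeds: the two OBJECT-level printed facts in place of any class-level transport fact -/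

section ObjectLevel

/-- **The integral lci ladder on Bloch (7.1) + Fulton alone.** BY NAME: `weilFamilyReach_similar` (REFEREED), `Bloch1972_semiregularSubschemeLifts`
(Bloch 1972 Thm. (7.1) + Hilbert point + Artin: a semiregular lci of the fibre lifts to an étale-local flat family) and
`fulton1998_flatFamily_cycleClass_specialises` (Fulton Cor. 10.1 ∕ 19.2: the fibre classes of a flat family are restrictions of one global class);
the class-level `BlochSemiregularSpread (2N) N` is DERIVED (`Bloch1972.blochSemiregularSpread_of_blochLifts_of_fulton`, s4-bridge-1, iso-invariance
discharged). BY VALUE: a polarized Weil-type `(N, d)` member of `(N, d, δ)`, `w ≠ 0` rational Weil, ONE integral Bloch-semiregular lci for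
`q·h_Kᴺ + w`. CONCLUSION: the §1 ladder. [cite: Bloch1972Semiregularity, Thm. (7.1) p. 64 and Thm. (7.4) with Remark (7.5) p. 65]
[cite: Fulton1998, §10.1 Cor. 10.1; §19.2 Cor. 19.2 (b)] [cite: Schoen1998HodgeWeilAddendum, 10 (Proposition), p. 332] [cite: Deligne1982HodgeCycles, proof of Thm. 4.8] -/
theorem componentLadder_of_blochLifts_of_fulton_of_blochSeedAt_member (hF : weilFamilyReach_similar)
    (hBl : Bloch1972_semiregularSubschemeLifts) (hFu : fulton1998_flatFamily_cycleClass_specialises) {N d : ℕ} {δ : weilNormResidueGroup d}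
    {P : AbelianVariety ℂ} {ψ₀ : P ⟶ P} (hW : IsWeilType P ψ₀ N d) (e : ProjectiveEmbedding P.X)
    {a : complexBetti (projectiveSpace e.n ℂ) 2} (haQ : IsRationalClass a) (ha0 : a ≠ 0)
    (hδ : HasWeilDiscriminantNondeg P ψ₀ N d (symmetrisedClass d P ψ₀ e a) δ)
    {w : complexBetti P.X (2 * N)} (hwW : w ∈ weilClassesOf P ψ₀ N d) (hwQ : IsRationalClass w) (hw0 : w ≠ 0)
    (hS : HasBlochSeedAt N P (symmetrisedClass d P ψ₀ e a) w) :
    WeilClassesComponent N d δ ∧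
      (∀ n : ℕ, 0 < n → n < N → ∀ δ' : weilNormResidueGroup d, WeilClassesComponent n d δ') ∧
      ∀ n : ℕ, 0 < n → n < N → WeilAlgebraicAll n d :=
  componentLadder_of_localClause_member hF hW e haQ ha0 hδ hwW hwQ hw0
    (weilAnchorLocalClause_of_blochSpread_of_blochSeedAt d
      (Bloch1972.blochSemiregularSpread_of_blochLifts_of_fulton (2 * N) N hBl hFu) hS)

/-- **COFINAL integral-lci-seeded members on ANY components ⟹ R∞, on the two object-level facts and the reach alone.** NOT `HC_AV`; nothing
instantiated. [cite: Bloch1972Semiregularity, Thm. (7.1) and Thm. (7.4)] [cite: Fulton1998, §10.1 Cor. 10.1] [cite: Weil1977HodgeRing, §3] -/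
theorem weilClassesImaginaryQuadratic_of_reach_of_blochLifts_of_fulton_of_cofinalBlochSeedMembers (hF : weilFamilyReach_similar)
    (hBl : Bloch1972_semiregularSubschemeLifts) (hFu : fulton1998_flatFamily_cycleClass_specialises)
    (hS : ∀ n : ℕ, 2 ≤ n → ∀ d : ℕ, 0 < d → ∃ (N : ℕ) (P : AbelianVariety ℂ) (ψ₀ : P ⟶ P) (e : ProjectiveEmbedding P.X)
      (a : complexBetti (projectiveSpace e.n ℂ) 2) (w : complexBetti P.X (2 * N)),
      n < N ∧ IsWeilType P ψ₀ N d ∧ IsRationalClass a ∧ a ≠ 0 ∧ w ∈ weilClassesOf P ψ₀ N d ∧ IsRationalClass w ∧ w ≠ 0 ∧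
        HasBlochSeedAt N P (symmetrisedClass d P ψ₀ e a) w) :
    WeilClassesImaginaryQuadratic :=
  weilClassesImaginaryQuadratic_of_reach_of_cofinalLocalClauseMembers hF fun n hn d hd ↦ by
    obtain ⟨N, P, ψ₀, e, a, w, hnN, hW, haQ, ha0, hwW, hwQ, hw0, hSeed⟩ := hS n hn d hd
    exact ⟨N, P, ψ₀, e, a, w, hnN, hW, haQ, ha0, hwW, hwQ, hw0, weilAnchorLocalClause_of_blochSpread_of_blochSeedAt d
      (Bloch1972.blochSemiregularSpread_of_blochLifts_of_fulton (2 * N) N hBl hFu) hSeed⟩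

end ObjectLevel

/-! ## §4 The cell's two STATEMENTS OF RECORD on ONE lci fact (+ BF Thm. 5.1 for the sheaf kind) -/

section StatementsOfRecord

/-- **Statement of record, split form, on ONE lci fact** — `Statement.weilClasses_algebraic_split_of_any_seed` with its two Bloch transport facts
(`BlochSemiregularSpread (2n) n`, `BlochSemiregularSpreadSmoothComponents (2n) n`) DERIVED from `BlochSemiregularSpreadOfSubscheme (2n) n`
(`blochSemiregularSpread_of_subscheme`, `blochSemiregularSpreadSmoothComponents_of_subscheme` with `Fulton1998_degreeFormula_complexOrientation_holds`):
for `n, d ≥ 1`, granting BY NAME that fact, BF Thm. 5.1 and Deligne's hyperbolic reach, a SPLIT `√-d`-Weil anchor of dimension `2n` with `w ≠ 0`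
rational Weil and ANY ONE of the cell's certified objects for `q·h_Kⁿ + w` (integral Bloch seed ∨ reduced union seed ∨ `I`-semiregular vector
bundle) makes the Weil plane of EVERY split `√-d`-Weil abelian `2n`-fold algebraic. [cite: Bloch1972Semiregularity, Thm. (7.4) and Remark (7.5)]
[cite: BuchweitzFlenner2003, Thm. 5.1 and Thm. 5.2] [cite: Deligne1982HodgeCycles, proof of Thm. 4.8] -/
theorem weilClasses_algebraic_split_of_any_seed_of_subschemeFact (n d : ℕ) (hn : 1 ≤ n) (hd : 1 ≤ d)
    (hBS : BlochSemiregularSpreadOfSubscheme (2 * n) n) (hBF : BuchweitzFlenner2003_variationalHodge_ISemiregular)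
    (hF : weilFamilyReach_hyperbolic)
    (P : AbelianVariety ℂ) (ψ₀ : P ⟶ P) (ι : ProjectiveEmbedding P.X) (a : complexBetti (projectiveSpace ι.n ℂ) 2)
    (w : complexBetti P.X (2 * n)) (hP : P.dim = 2 * n) (hψ : ψ₀ ≫ ψ₀ = -(d • 𝟙 P)) (ha : IsRationalClass a)
    (ha0 : a ≠ 0) (hhyp : IsHyperbolicWeilType P ψ₀ n (symmetrisedClass d P ψ₀ ι a))
    (hwW : w ∈ weilClassesOf P ψ₀ n d) (hwr : IsRationalClass w) (hw0 : w ≠ 0)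
    (hseed : HasBlochSeedAt n P (symmetrisedClass d P ψ₀ ι a) w ∨
      HasBlochUnionSeedAt n P (symmetrisedClass d P ψ₀ ι a) w ∨
      ∃ (C : ChernCharacterBetti) (I : Finset ℕ), HasBFSheafSeedAt C n I P (symmetrisedClass d P ψ₀ ι a) w)
    (A : AbelianVariety ℂ) (φ : A ⟶ A) (hA : A.dim = 2 * n) (hφ : φ ≫ φ = -(d • 𝟙 A))
    (eA : ProjectiveEmbedding A.X) (aA : complexBetti (projectiveSpace eA.n ℂ) 2) (haA : IsRationalClass aA)
    (haA0 : aA ≠ 0) (hhypA : IsHyperbolicWeilType A φ n (symmetrisedClass d A φ eA aA)) :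
    weilClassesOf A φ n d ≤ algebraicClasses A.X n :=
  weilClasses_algebraic_split_of_any_seed n d hn hd (blochSemiregularSpread_of_subscheme hBS)
    (blochSemiregularSpreadSmoothComponents_of_subscheme Fulton1998_degreeFormula_complexOrientation_holds hBS) hBF hF P ψ₀ ι a w
    hP hψ ha ha0 hhyp hwW hwr hw0 hseed A φ hA hφ eA aA haA haA0 hhypA

/-- **Statement of record, component form, on ONE lci fact** — `Statement.weilClasses_algebraic_of_similar_any_seed` over
`BlochSemiregularSpreadOfSubscheme (2n) n`, BF Thm. 5.1 and Deligne's reach-by-similitude: the Weil plane of every `√-d`-Weil `2n`-fold carrying a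
non-zero `(n,n)` Weil class and Weil-similar to the seeded anchor is algebraic — at `n = 3` on a NON-split anchor, the cell's first open target.
[cite: Bloch1972Semiregularity, Thm. (7.4) and Remark (7.5)] [cite: BuchweitzFlenner2003, Thm. 5.1 and Thm. 5.2] [cite: Deligne1982HodgeCycles, proof of Thm. 4.8] -/
theorem weilClasses_algebraic_of_similar_any_seed_of_subschemeFact {n d : ℕ} (hn : 1 ≤ n) (hd : 1 ≤ d)
    (hBS : BlochSemiregularSpreadOfSubscheme (2 * n) n) (hBF : BuchweitzFlenner2003_variationalHodge_ISemiregular)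
    (hF : weilFamilyReach_similar)
    (P : AbelianVariety ℂ) (ψ₀ : P ⟶ P) (ι : ProjectiveEmbedding P.X) (a : complexBetti (projectiveSpace ι.n ℂ) 2)
    (w : complexBetti P.X (2 * n)) (hP : P.dim = 2 * n) (hψ : ψ₀ ≫ ψ₀ = -(d • 𝟙 P)) (ha : IsRationalClass a)
    (ha0 : a ≠ 0) (hwW : w ∈ weilClassesOf P ψ₀ n d) (hwr : IsRationalClass w) (hw0 : w ≠ 0)
    (hwH : IsOfHodgeType (2 * n) P.X (2 * n) n n w)
    (hseed : HasBlochSeedAt n P (symmetrisedClass d P ψ₀ ι a) w ∨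
      HasBlochUnionSeedAt n P (symmetrisedClass d P ψ₀ ι a) w ∨
      ∃ (C : ChernCharacterBetti) (I : Finset ℕ), HasBFSheafSeedAt C n I P (symmetrisedClass d P ψ₀ ι a) w)
    (A : AbelianVariety ℂ) (φ : A ⟶ A) (hA : A.dim = 2 * n) (hφ : φ ≫ φ = -(d • 𝟙 A))
    (hWA : ∃ wA : complexBetti A.X (2 * n),
      wA ∈ weilClassesOf A φ n d ∧ wA ≠ 0 ∧ IsOfHodgeType (2 * n) A.X (2 * n) n n wA)
    (eA : ProjectiveEmbedding A.X) (aA : complexBetti (projectiveSpace eA.n ℂ) 2) (haA : IsRationalClass aA)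
    (haA0 : aA ≠ 0)
    (hsim : IsWeilSimilar n P ψ₀ (symmetrisedClass d P ψ₀ ι a) A φ (symmetrisedClass d A φ eA aA)) :
    weilClassesOf A φ n d ≤ algebraicClasses A.X n :=
  weilClasses_algebraic_of_similar_any_seed hn hd (blochSemiregularSpread_of_subscheme hBS)
    (blochSemiregularSpreadSmoothComponents_of_subscheme Fulton1998_degreeFormula_complexOrientation_holds hBS) hBF hF P ψ₀ ι a w
    hP hψ ha ha0 hwW hwr hw0 hwH hseed A φ hA hφ hWA eA aA haA haA0 hsim

end StatementsOfRecord

/-! ## §5 Readings at `N = 3` (the deciding-row form of § V-1) and `N = 4` (§ g = 8: every row deciding), on one lci fact -/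

section Readings

/-- **`g = 6`, one lci fact.** Reach-by-similitude ∧ `BlochSemiregularSpreadOfSubscheme 6 3` ∧ ONE lci seed (integral ∨ union ∨ subscheme) on a
Weil-type `(3, d)` member of the sixfold cell `(3, d, δ)` — split or NOT — ⟹ that cell ∧ every fourfold cell `(2, d, δ')` ∧ `WeilAlgebraicAll 2 d`
(Markman's fourfold statement for `ℚ(√-d)`, in print). By the signed census (v3.77, 134 deciding rows: NO-in-families-tried) no row supplies the
seed on a non-split cell. [cite: Bloch1972Semiregularity, Thm. (7.4) and Remark (7.5)] [cite: Schoen1998HodgeWeilAddendum, 10 (Proposition), p. 332]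
[cite: Markman2025SecantWeil, Thm. 1.5.1 and Cor. 1.6.1 (preprint)] -/
theorem sixfoldComponent_and_fourfolds_of_reach_of_subschemeFact_of_lciSeed_member (hF : weilFamilyReach_similar) {d : ℕ}
    {δ : weilNormResidueGroup d} (hBS : BlochSemiregularSpreadOfSubscheme (2 * 3) 3)
    {P : AbelianVariety ℂ} {ψ₀ : P ⟶ P} (hW : IsWeilType P ψ₀ 3 d) (e : ProjectiveEmbedding P.X)
    {a : complexBetti (projectiveSpace e.n ℂ) 2} (haQ : IsRationalClass a) (ha0 : a ≠ 0)
    (hδ : HasWeilDiscriminantNondeg P ψ₀ 3 d (symmetrisedClass d P ψ₀ e a) δ)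
    {w : complexBetti P.X (2 * 3)} (hwW : w ∈ weilClassesOf P ψ₀ 3 d) (hwQ : IsRationalClass w) (hw0 : w ≠ 0)
    (hseed : HasBlochSeedAt 3 P (symmetrisedClass d P ψ₀ e a) w ∨ HasBlochUnionSeedAt 3 P (symmetrisedClass d P ψ₀ e a) w ∨
      HasBlochSubschemeSeedAt 3 P (symmetrisedClass d P ψ₀ e a) w) :
    WeilClassesComponent 3 d δ ∧ (∀ δ' : weilNormResidueGroup d, WeilClassesComponent 2 d δ') ∧ WeilAlgebraicAll 2 d :=
  have h := componentLadder_of_subschemeFact_of_lciSeed_member hF hBS hW e haQ ha0 hδ hwW hwQ hw0 hseed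
  ⟨h.1, h.2.1 2 (by norm_num) (by norm_num), h.2.2 2 (by norm_num) (by norm_num)⟩

/-- **`g = 8`, one lci fact — every row deciding.** Reach-by-similitude ∧ `BlochSemiregularSpreadOfSubscheme 8 4` ∧ ONE lci seed on a Weil-type
`(4, d)` member of ANY eightfold component ⟹ that component ∧ EVERY sixfold cell `(3, d, δ')` (the non-split g = 6 cells included) ∧ every
fourfold cell ∧ `WeilAlgebraicAll 3 d ∧ WeilAlgebraicAll 2 d`. The g = 8 census of record reads NO-in-families-tried (`CensusG8.outcome_g8`).
[cite: Bloch1972Semiregularity, Thm. (7.4) and Remark (7.5)] [cite: Schoen1998HodgeWeilAddendum, 10 (Proposition), p. 332]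
[cite: Markman2025SurveySecant, §11.5 Step 2 and §12 (preprint)] -/
theorem eightfoldComponent_and_below_of_reach_of_subschemeFact_of_lciSeed_member (hF : weilFamilyReach_similar) {d : ℕ}
    {δ : weilNormResidueGroup d} (hBS : BlochSemiregularSpreadOfSubscheme (2 * 4) 4)
    {P : AbelianVariety ℂ} {ψ₀ : P ⟶ P} (hW : IsWeilType P ψ₀ 4 d) (e : ProjectiveEmbedding P.X)
    {a : complexBetti (projectiveSpace e.n ℂ) 2} (haQ : IsRationalClass a) (ha0 : a ≠ 0)
    (hδ : HasWeilDiscriminantNondeg P ψ₀ 4 d (symmetrisedClass d P ψ₀ e a) δ)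
    {w : complexBetti P.X (2 * 4)} (hwW : w ∈ weilClassesOf P ψ₀ 4 d) (hwQ : IsRationalClass w) (hw0 : w ≠ 0)
    (hseed : HasBlochSeedAt 4 P (symmetrisedClass d P ψ₀ e a) w ∨ HasBlochUnionSeedAt 4 P (symmetrisedClass d P ψ₀ e a) w ∨
      HasBlochSubschemeSeedAt 4 P (symmetrisedClass d P ψ₀ e a) w) :
    WeilClassesComponent 4 d δ ∧ (∀ δ' : weilNormResidueGroup d, WeilClassesComponent 3 d δ') ∧
      (∀ δ' : weilNormResidueGroup d, WeilClassesComponent 2 d δ') ∧ WeilAlgebraicAll 3 d ∧ WeilAlgebraicAll 2 d :=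
  have h := componentLadder_of_subschemeFact_of_lciSeed_member hF hBS hW e haQ ha0 hδ hwW hwQ hw0 hseed
  ⟨h.1, h.2.1 3 (by norm_num) (by norm_num), h.2.1 2 (by norm_num) (by norm_num), h.2.2 3 (by norm_num) (by norm_num),
    h.2.2 2 (by norm_num) (by norm_num)⟩

end Readings

/-! ## Audit: nothing is decided here
Every theorem with a Weil ∕ Hodge conclusion carries among its hypotheses a SEED or the LOCAL CLAUSE at a Weil-type member (none on a deciding
component in the signed census) AND, BY NAME, the refereed reach (§4 split form: the hyperbolic reach) and — §2 ∕ §4 ∕ §5 — ONE refereed lci fact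
`BlochSemiregularSpreadOfSubscheme (2N) N` (+ BF Thm. 5.1 for the sheaf kind in §4), or — §3 — the two object-level printed facts. The descent is
Schoen's ladder (tree theorems); §1's general-member arrows are ring 2's van Geemen 6.12 theorems. NOT `HC_AV`. No definition, no named fact, no `sorry`. -/

end Summit.Ventures.HSemireg

end
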